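import Literature.AlgebraicGeometry.ShimuraVarieties.UnitaryAuxiliaryComplexStructure
import HarnessLib

/-!
# Equivariance of the complex structure `J_{β,Φ}(z)` under `U(H)(L⁺)`:
# `J_{β,Φ}(γ • z) = ũ(γ, 1)_ℝ · J_{β,Φ}(z) · ũ(γ, 1)_ℝ⁻¹` (Deligne 1979, Prop. 2.3.10; Milne 2005, Lemma 5.13)

Topic `AlgebraicGeometry/ShimuraVarieties`; namespace `Literature.AlgebraicGeometry.ShimuraVarieties.UnitaryCanonicalModel.Aux`.
One definition with body (`unitaryToTensorReal`, the transport `U(H)(ℚ) → GL₃(ℝ ⊗_ℚ M)`, twin of ★ (g-a3)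
`unitaryToTensorRat`/`unitaryToTensorFin`) and theorems; no named fact, no instance, nothing asserted (net debt 0).
Layer (g-b′) of the I-1′ receptacle (cell hodgecm-mathlib; B-plan2 T3 pen 13:38:28Z (2): «EQUIVARIANCE making the
Shimura-SET map well defined (S2pair (i)): for `γ ∈ rational … 3 H` acting on `Ball` through the frame, `auxComplexStructure
F Φ T (γ • z) = conjJ (g_ℝ) (auxComplexStructure F Φ T z)` with `g_ℝ :=` the real image of `auxToGspRat F (γ, 1)`»), over
★ (g-b) `UnitaryAuxiliaryComplexStructure` (B-typ01: `projJ`, `reflJ`, `reflFrame`, `sComp`, `sMat`, `sPhi`, `realEmb`,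
`auxComplexStructure`), ★ (g-a3) `UnitaryAuxiliarySymplecticAdelic` (`auxToGspRat`, `map_auxRep`), ★ (σ1)/(σ2)
(`gspRationalToReal`, `conjJ`) and the tree's frame action ★ `ratToU21 L H τ T hT : U(H)(L⁺) →* U(2,1)`, `γ ↦ T⁻¹γ^τT`,
with ★ `UnitaryShimuraHeckeComplex.mulVec_frame_lift_ratToU21_smul` («`γ^τ·T·lift x = c • T·lift(ρ(γ)•x)`, `c ≠ 0`»).

The argument (every step PROVED here):
* §1 `formJ_mulVec`, `projJ_mulVec`, **`reflJ_mulVec`** — the `J`-projection/reflection in the line `ℂw` is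
  EQUIVARIANT under `U(J)`: `r_{g w} = g r_w g⁻¹` for `gᴴ J g = J` (the `GL`-spelled corollaries of ★
  `projJ_mulVec_of_unitary` / ★ `reflJ_mulVec_of_unitary` of (g-b) §6; invariant under `w ↦ c w`, ★ `reflJ_smul`).
* §2 **`reflFrame_lift_ratToU21_smul`** — in the frame `T` of `H^τ` (`Tᴴ H^τ T = J`): the `H^τ`-reflection in the
  negative line of `ρ(γ) • z` is `γ^τ · (reflection for z) · (γ^τ)⁻¹`, because `lift(ρ(γ)•z) = c⁻¹ · (T⁻¹γ^τT)·lift z`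
  and `T⁻¹γ^τT ∈ U(J)` (★ `conjTranspose_map_mul_map`: `γ^τ ∈ U(H^τ)`).
* §3 `unitaryToTensorReal` + `map_realEmb_unitaryToTensorReal` (its `ρ`-component is `γ^{ρ∘j}`), **`sPhi_ratToU21_smul`**:
  `s_{γ•z} = X_γ s_z X_γ⁻¹` in `GL₃(ℝ ⊗_ℚ M)` — componentwise at each `ρ ∈ Φ` (★ `matrix_eq_of_realEmb_eq`): §2 over `τ`,
  `1 = γ 1 γ⁻¹` elsewhere.
* §4 **`coe_gspRationalToReal_auxToGspRat_one`** — the real square: `(gspRationalToReal δ (auxToGspRat F (γ,1)) : GL) =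
  auxRep ℝ F (1, X_γ)` (★ `map_auxRep (Algebra.ofId ℚ ℝ)`), and **`auxComplexStructure_ratToU21_smul`**:
  `J_{β,Φ}(ρ(γ)•z) = conjJ g_ℝ (J_{β,Φ}(z))`, `g_ℝ := gspRationalToReal δ (auxToGspRat F (γ, 1))` — the `(x ↦ γx, a ↦ γa)`
  compatibility that makes `[x, a] ↦ [J(x), ũ(a, t)]` descend to `U(H)(ℚ)`-double cosets (σ2 ★ `SiegelShimuraSet.mk_eq_mk_iff`);
  `coe_gspRationalToReal_auxToGspRat_torus`, **`auxComplexStructure_torus_invariant`** (`conjJ (ũ(1, m)_ℝ) J = J` for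
  `m ∈ T₀(M)(ℚ)`: the torus half — changing the representative `t_p` by a rational element) and the combined
  `auxComplexStructure_ratToU21_smul_torus`.
* §5 **`auxPoint_ratToU21_smul`**, `conjAct_torus_auxPoint` — the same in the `C0pm δ`-typed currency of σ2 (★ `conjAct`,
  over (g-b) §6 ★ `auxPoint`): `auxPoint (ρ(γ)•z) = conjAct δ (ũ(γ, m)_ℝ) (auxPoint z)`.

## References
* [Deligne1979ShimuraVarieties] P. Deligne, *Variétés de Shimura* (1979), Prop. 2.3.10 and 2.1.2 (PDF pp. 32, 24 of Milne's
  translation: the morphism of Shimura data `(G, X) → (CSp(V), S^±)` is `G(ℝ)`-equivariant on `X` by construction, `h ↦ ad(g) ∘ h`).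
* [Milne2005ShimuraVarieties] J. S. Milne, *Introduction to Shimura varieties* (2005), Lemma 5.13 p. 57, §6 p. 68 («`J ↦ gJg⁻¹`»).
* [Jacobowitz1990] H. Jacobowitz, *An introduction to CR structures* (1990), Ch. 2 §1 (p. 40–41): the fractional-linear
  action of `U(2,1)` on `𝔹²` through the lift `(z, 1)`.
-/

set_option autoImplicit false

noncomputable section

open Matrix NumberField
open scoped TensorProduct ComplexConjugate

namespace Literature.AlgebraicGeometry.ShimuraVarieties

namespace UnitaryCanonicalModel

namespace Aux

open Literature.AlgebraicGeometry.ModuliOfAbelianVarieties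
open Literature.AlgebraicGeometry.Motives (CMType)
open Literature.Geometry.ComplexHyperbolic
open Literature.NumberTheory.Automorphic (formCongr formCongr_star)
open Literature.NumberTheory.Automorphic.UnitaryGroup

/-! ### §1. The `J`-reflection is `U(J)`-equivariant -/

section ReflectionEquivariance

/-- `q(g w) = q(w)` for `g ∈ U(J)` (`gᴴ J g = J`). [cite: Jacobowitz1990, Ch. 2 §1 (p. 40)] -/
theorem formJ_mulVec {g : Matrix (Fin 3) (Fin 3) ℂ} (hg : gᴴ * BallModel.J * g = BallModel.J) (w : Fin 3 → ℂ) :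
    formJ (g *ᵥ w) = formJ w := by
  rw [formJ, formJ, Matrix.star_mulVec, Matrix.mulVec_mulVec, ← Matrix.dotProduct_mulVec, Matrix.mulVec_mulVec,
    ← Matrix.mul_assoc, hg]

/-- **`P_{g w} = g P_w g⁻¹` for `g ∈ U(J)`**: the `J`-orthogonal projection onto a line is `U(J)`-equivariant.
[cite: Deligne1979ShimuraVarieties, Prop. 2.3.10 (PDF p. 32)] [cite: Milne2005ShimuraVarieties, §6 p. 68] -/
theorem projJ_mulVec (g : GL (Fin 3) ℂ)
    (hg : ((g : Matrix (Fin 3) (Fin 3) ℂ))ᴴ * BallModel.J * (g : Matrix (Fin 3) (Fin 3) ℂ) = BallModel.J) (w : Fin 3 → ℂ) :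
    projJ ((g : Matrix (Fin 3) (Fin 3) ℂ) *ᵥ w) =
      (g : Matrix (Fin 3) (Fin 3) ℂ) * projJ w * ((g⁻¹ : GL (Fin 3) ℂ) : Matrix (Fin 3) (Fin 3) ℂ) :=
  projJ_mulVec_of_unitary hg (by rw [← Units.val_mul, mul_inv_cancel, Units.val_one]) w

/-- **`r_{g w} = g r_w g⁻¹` for `g ∈ U(J)`**: the `J`-reflection in a line is `U(J)`-equivariant.
[cite: Deligne1979ShimuraVarieties, Prop. 2.3.10 (PDF p. 32)] [cite: Milne2005ShimuraVarieties, §6 p. 68] -/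
theorem reflJ_mulVec (g : GL (Fin 3) ℂ)
    (hg : ((g : Matrix (Fin 3) (Fin 3) ℂ))ᴴ * BallModel.J * (g : Matrix (Fin 3) (Fin 3) ℂ) = BallModel.J) (w : Fin 3 → ℂ) :
    reflJ ((g : Matrix (Fin 3) (Fin 3) ℂ) *ᵥ w) =
      (g : Matrix (Fin 3) (Fin 3) ℂ) * reflJ w * ((g⁻¹ : GL (Fin 3) ℂ) : Matrix (Fin 3) (Fin 3) ℂ) :=
  reflJ_mulVec_of_unitary hg (by rw [← Units.val_mul, mul_inv_cancel, Units.val_one]) w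

end ReflectionEquivariance

/-! ### §2. The frame reflection at `ρ(γ) • z` -/

section FrameEquivariance

variable {L : Type} [Field L] [NumberField L] [IsCMField L] {H : Matrix (Fin 3) (Fin 3) L} {τ : L →+* ℂ}
  {T : GL (Fin 3) ℂ} {hT : formCongr (starRingEnd ℂ) T (H.map τ) = BallModel.J}

omit [NumberField L] [IsCMField L] in
/-- `(T⁻¹)ᴴ J T⁻¹ = H^τ` when `Tᴴ H^τ T = J`. [folklore] -/
private theorem conjTranspose_inv_mul_J_mul_inv
    (hT' : ((T : Matrix (Fin 3) (Fin 3) ℂ))ᴴ * H.map τ * (T : Matrix (Fin 3) (Fin 3) ℂ) = BallModel.J) :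
    (((T⁻¹ : GL (Fin 3) ℂ) : Matrix (Fin 3) (Fin 3) ℂ))ᴴ * BallModel.J * ((T⁻¹ : GL (Fin 3) ℂ) : Matrix (Fin 3) (Fin 3) ℂ) =
      H.map τ := by
  rw [← hT']
  calc (((T⁻¹ : GL (Fin 3) ℂ) : Matrix (Fin 3) (Fin 3) ℂ))ᴴ *
        (((T : Matrix (Fin 3) (Fin 3) ℂ))ᴴ * H.map τ * (T : Matrix (Fin 3) (Fin 3) ℂ)) *
        ((T⁻¹ : GL (Fin 3) ℂ) : Matrix (Fin 3) (Fin 3) ℂ)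
      = ((T : Matrix (Fin 3) (Fin 3) ℂ) * ((T⁻¹ : GL (Fin 3) ℂ) : Matrix (Fin 3) (Fin 3) ℂ))ᴴ * H.map τ *
          ((T : Matrix (Fin 3) (Fin 3) ℂ) * ((T⁻¹ : GL (Fin 3) ℂ) : Matrix (Fin 3) (Fin 3) ℂ)) := by
        rw [Matrix.conjTranspose_mul]; simp only [Matrix.mul_assoc]
    _ = H.map τ := by
        rw [← Units.val_mul, mul_inv_cancel, Units.val_one, Matrix.conjTranspose_one, Matrix.one_mul, Matrix.mul_one]

/-- `T⁻¹ γ^τ T ∈ U(J)` for `γ ∈ U(H)(L⁺)` (`γ^τ ∈ U(H^τ)`, ★ `conjTranspose_map_mul_map`, transported by the frame).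
[cite: Milne2005ShimuraVarieties, Lemma 5.13 p. 57] -/
theorem conjTranspose_frameConj_mul_J_mul (hT : formCongr (starRingEnd ℂ) T (H.map τ) = BallModel.J)
    (γ : rational (↥(maximalRealSubfield L)) L (IsCMField.complexConj L) 3 H) :
    (((T⁻¹ * Matrix.GeneralLinearGroup.map τ (γ : GL (Fin 3) L) * T : GL (Fin 3) ℂ) : Matrix (Fin 3) (Fin 3) ℂ))ᴴ *
        BallModel.J *
        ((T⁻¹ * Matrix.GeneralLinearGroup.map τ (γ : GL (Fin 3) L) * T : GL (Fin 3) ℂ) : Matrix (Fin 3) (Fin 3) ℂ) =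
      BallModel.J := by
  have hT' : ((T : Matrix (Fin 3) (Fin 3) ℂ))ᴴ * H.map τ * (T : Matrix (Fin 3) (Fin 3) ℂ) = BallModel.J := by
    rw [← formCongr_star]; exact hT
  have hγ := conjTranspose_map_mul_map (τ := τ) γ
  have hinv := conjTranspose_inv_mul_J_mul_inv hT'
  rw [Units.val_mul, Units.val_mul, Matrix.conjTranspose_mul, Matrix.conjTranspose_mul]
  calc ((T : Matrix (Fin 3) (Fin 3) ℂ))ᴴ *
        ((((Matrix.GeneralLinearGroup.map τ (γ : GL (Fin 3) L) : GL (Fin 3) ℂ) : Matrix (Fin 3) (Fin 3) ℂ))ᴴ *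
          (((T⁻¹ : GL (Fin 3) ℂ) : Matrix (Fin 3) (Fin 3) ℂ))ᴴ) * BallModel.J *
        (((T⁻¹ : GL (Fin 3) ℂ) : Matrix (Fin 3) (Fin 3) ℂ) *
          ((Matrix.GeneralLinearGroup.map τ (γ : GL (Fin 3) L) : GL (Fin 3) ℂ) : Matrix (Fin 3) (Fin 3) ℂ) *
          (T : Matrix (Fin 3) (Fin 3) ℂ))
      = ((T : Matrix (Fin 3) (Fin 3) ℂ))ᴴ *
          ((((Matrix.GeneralLinearGroup.map τ (γ : GL (Fin 3) L) : GL (Fin 3) ℂ) : Matrix (Fin 3) (Fin 3) ℂ))ᴴ *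
            ((((T⁻¹ : GL (Fin 3) ℂ) : Matrix (Fin 3) (Fin 3) ℂ))ᴴ * BallModel.J *
              ((T⁻¹ : GL (Fin 3) ℂ) : Matrix (Fin 3) (Fin 3) ℂ)) *
            ((Matrix.GeneralLinearGroup.map τ (γ : GL (Fin 3) L) : GL (Fin 3) ℂ) : Matrix (Fin 3) (Fin 3) ℂ)) *
          (T : Matrix (Fin 3) (Fin 3) ℂ) := by simp only [Matrix.mul_assoc]
    _ = BallModel.J := by rw [hinv, hγ, hT']

/-- `lift(ρ(γ) • z) = c⁻¹ • (T⁻¹ γ^τ T)·lift z` for the non-zero `c` of ★ `mulVec_frame_lift_ratToU21_smul`.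
[cite: Jacobowitz1990, Ch. 2 §1 (p. 40)] [cite: Milne2005ShimuraVarieties, Lemma 5.13 p. 57] -/
theorem exists_lift_ratToU21_smul_eq (γ : rational (↥(maximalRealSubfield L)) L (IsCMField.complexConj L) 3 H)
    (z : BallModel.Ball) :
    ∃ c : ℂ, c ≠ 0 ∧ BallModel.lift (ratToU21 L H τ T hT γ • z) =
      c⁻¹ • (((T⁻¹ * Matrix.GeneralLinearGroup.map τ (γ : GL (Fin 3) L) * T : GL (Fin 3) ℂ) : Matrix (Fin 3) (Fin 3) ℂ) *ᵥ
        BallModel.lift z) := by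
  obtain ⟨c, hc, h⟩ := mulVec_frame_lift_ratToU21_smul (hT := hT) γ z
  refine ⟨c, hc, ?_⟩
  have h1 : (T : Matrix (Fin 3) (Fin 3) ℂ) *ᵥ BallModel.lift (ratToU21 L H τ T hT γ • z) =
      c⁻¹ • (((Matrix.GeneralLinearGroup.map τ (γ : GL (Fin 3) L) : GL (Fin 3) ℂ) : Matrix (Fin 3) (Fin 3) ℂ) *ᵥ
        ((T : Matrix (Fin 3) (Fin 3) ℂ) *ᵥ BallModel.lift z)) := by
    rw [h, smul_smul, inv_mul_cancel₀ hc, one_smul]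
  calc BallModel.lift (ratToU21 L H τ T hT γ • z)
      = ((T⁻¹ : GL (Fin 3) ℂ) : Matrix (Fin 3) (Fin 3) ℂ) *ᵥ
          ((T : Matrix (Fin 3) (Fin 3) ℂ) *ᵥ BallModel.lift (ratToU21 L H τ T hT γ • z)) := by
        rw [Matrix.mulVec_mulVec, ← Units.val_mul, inv_mul_cancel, Units.val_one, Matrix.one_mulVec]
    _ = c⁻¹ • (((T⁻¹ * Matrix.GeneralLinearGroup.map τ (γ : GL (Fin 3) L) * T : GL (Fin 3) ℂ) :
          Matrix (Fin 3) (Fin 3) ℂ) *ᵥ BallModel.lift z) := by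
        rw [h1, Matrix.mulVec_smul, Matrix.mulVec_mulVec, Matrix.mulVec_mulVec, Units.val_mul, Units.val_mul]

/-- **The frame reflection is `γ^τ`-equivariant**: `s(T, lift(ρ(γ)•z)) = γ^τ · s(T, lift z) · (γ^τ)⁻¹` — the
`H^τ`-reflection in the negative line of `ρ(γ)•z` is the conjugate by the isometry `γ^τ` of the one for `z`.
[cite: Deligne1979ShimuraVarieties, Prop. 2.3.10 (PDF p. 32)] [cite: Milne2005ShimuraVarieties, Lemma 5.13 p. 57, §6 p. 68] -/
theorem reflFrame_lift_ratToU21_smul (γ : rational (↥(maximalRealSubfield L)) L (IsCMField.complexConj L) 3 H)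
    (z : BallModel.Ball) :
    reflFrame T (BallModel.lift (ratToU21 L H τ T hT γ • z)) =
      ((Matrix.GeneralLinearGroup.map τ (γ : GL (Fin 3) L) : GL (Fin 3) ℂ) : Matrix (Fin 3) (Fin 3) ℂ) *
        reflFrame T (BallModel.lift z) *
        (((Matrix.GeneralLinearGroup.map τ (γ : GL (Fin 3) L))⁻¹ : GL (Fin 3) ℂ) : Matrix (Fin 3) (Fin 3) ℂ) := by
  obtain ⟨c, hc, hlift⟩ := exists_lift_ratToU21_smul_eq (hT := hT) γ z
  rw [reflFrame, reflFrame, hlift, reflJ_smul (inv_ne_zero hc),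
    reflJ_mulVec _ (conjTranspose_frameConj_mul_J_mul hT γ)]
  simp only [Units.val_mul, _root_.mul_inv_rev, inv_inv, Matrix.mul_assoc, Units.mul_inv_cancel_left, Units.mul_inv,
    Matrix.mul_one]

end FrameEquivariance

/-! ### §3. Transport of `U(H)(ℚ)` to `GL₃(ℝ ⊗_ℚ M)` and equivariance of `s_z` -/

section Real

variable {L : Type} [Field L] [NumberField L] [IsCMField L] (M : Type) [Field M] [NumberField M]
  (j : L →+* M) (H : Matrix (Fin 3) (Fin 3) L)

/-- **Transport of `U(H)(ℚ) ≤ GL₃(L)` into `GL₃(ℝ ⊗_ℚ M)`** (`a ↦ 1 ⊗ j(a)` entrywise): the real points of the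
group-map carrier, i.e. ★ `unitaryToTensorRat` followed by `ℚ ⊗ M → ℝ ⊗ M` — the spelling produced by ★ `map_auxRep
(Algebra.ofId ℚ ℝ)`. [cite: Deligne1979ShimuraVarieties, Prop. 2.3.10, 2.1.2 (PDF pp. 32, 24)] -/
def unitaryToTensorReal :
    ↥(rational (↥(maximalRealSubfield L)) L (IsCMField.complexConj L) 3 H) →* GL (Fin 3) (ℝ ⊗[ℚ] M) :=
  (Matrix.GeneralLinearGroup.map
      ((Algebra.TensorProduct.map (Algebra.ofId ℚ ℝ) (AlgHom.id ℚ M) : ℚ ⊗[ℚ] M →ₐ[ℚ] ℝ ⊗[ℚ] M) :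
        ℚ ⊗[ℚ] M →+* ℝ ⊗[ℚ] M)).comp (unitaryToTensorRat M j H)

/-- Entries of `unitaryToTensorReal γ`: `1 ⊗ j(γ_{ab})`. [cite: Deligne1979ShimuraVarieties, Prop. 2.3.10 (PDF p. 32)] -/
theorem coe_unitaryToTensorReal_apply (γ : rational (↥(maximalRealSubfield L)) L (IsCMField.complexConj L) 3 H)
    (a b : Fin 3) :
    ((unitaryToTensorReal M j H γ : GL (Fin 3) (ℝ ⊗[ℚ] M)) : Matrix (Fin 3) (Fin 3) (ℝ ⊗[ℚ] M)) a b =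
      (1 : ℝ) ⊗ₜ j (((γ : GL (Fin 3) L) : Matrix (Fin 3) (Fin 3) L) a b) := by
  change Algebra.TensorProduct.map (Algebra.ofId ℚ ℝ) (AlgHom.id ℚ M) (ratToTensor M j _) = _
  rw [ratToTensor_apply, Algebra.TensorProduct.map_tmul, map_one, AlgHom.id_apply]
  rfl

/-- **The `ρ`-component of `unitaryToTensorReal γ` is `γ^{ρ∘j}`** (`ρ ∈ Φ`). [cite: Shimura1998, §6.2 Thm. 4, p. 44] -/
theorem map_realEmb_unitaryToTensorReal (Φ : CMType M) (ρ : Φ.1)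
    (γ : rational (↥(maximalRealSubfield L)) L (IsCMField.complexConj L) 3 H) :
    ((unitaryToTensorReal M j H γ : GL (Fin 3) (ℝ ⊗[ℚ] M)) : Matrix (Fin 3) (Fin 3) (ℝ ⊗[ℚ] M)).map (realEmb M Φ ρ) =
      ((Matrix.GeneralLinearGroup.map (ρ.1.comp j) (γ : GL (Fin 3) L) : GL (Fin 3) ℂ) : Matrix (Fin 3) (Fin 3) ℂ) := by
  ext a b
  rw [Matrix.map_apply, coe_unitaryToTensorReal_apply, realEmb_tmul, Complex.ofReal_one, one_mul]
  rfl

/-- The `ρ`-component of `(unitaryToTensorReal γ)⁻¹` is `(γ^{ρ∘j})⁻¹`. [cite: Shimura1998, §6.2 Thm. 4, p. 44] -/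
theorem map_realEmb_unitaryToTensorReal_inv (Φ : CMType M) (ρ : Φ.1)
    (γ : rational (↥(maximalRealSubfield L)) L (IsCMField.complexConj L) 3 H) :
    (((unitaryToTensorReal M j H γ)⁻¹ : GL (Fin 3) (ℝ ⊗[ℚ] M)) : Matrix (Fin 3) (Fin 3) (ℝ ⊗[ℚ] M)).map (realEmb M Φ ρ) =
      (((Matrix.GeneralLinearGroup.map (ρ.1.comp j) (γ : GL (Fin 3) L))⁻¹ : GL (Fin 3) ℂ) : Matrix (Fin 3) (Fin 3) ℂ) := by
  rw [← map_inv, ← map_inv]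
  exact map_realEmb_unitaryToTensorReal M j H Φ ρ γ⁻¹

variable {M j H} (Φ : CMType M) {τ : L →+* ℂ} {T : GL (Fin 3) ℂ}
  {hT : formCongr (starRingEnd ℂ) T (H.map τ) = BallModel.J}

/-- **`s_{ρ(γ)•z} = X_γ · s_z · X_γ⁻¹` in `M₃(ℝ ⊗_ℚ M)`** (`X_γ = unitaryToTensorReal γ`): componentwise at `ρ ∈ Φ` over `τ`
it is ★ `reflFrame_lift_ratToU21_smul`, at the other `ρ ∈ Φ` it is `1 = γ·1·γ⁻¹`.
[cite: Deligne1979ShimuraVarieties, Prop. 2.3.10 (PDF p. 32)] [cite: Milne2005ShimuraVarieties, §6 p. 68] -/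
theorem sMat_lift_ratToU21_smul (γ : rational (↥(maximalRealSubfield L)) L (IsCMField.complexConj L) 3 H)
    (z : BallModel.Ball) :
    sMat M j Φ τ T (BallModel.lift (ratToU21 L H τ T hT γ • z)) =
      ((unitaryToTensorReal M j H γ : GL (Fin 3) (ℝ ⊗[ℚ] M)) : Matrix (Fin 3) (Fin 3) (ℝ ⊗[ℚ] M)) *
        sMat M j Φ τ T (BallModel.lift z) *
        (((unitaryToTensorReal M j H γ)⁻¹ : GL (Fin 3) (ℝ ⊗[ℚ] M)) : Matrix (Fin 3) (Fin 3) (ℝ ⊗[ℚ] M)) := by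
  refine matrix_eq_of_realEmb_eq M Φ fun ρ => ?_
  rw [Matrix.map_mul, Matrix.map_mul, sMat_map_realEmb, sMat_map_realEmb, map_realEmb_unitaryToTensorReal,
    map_realEmb_unitaryToTensorReal_inv]
  by_cases h : ρ.1.comp j = τ
  · rw [sComp_of_eq _ h, sComp_of_eq _ h, reflFrame_lift_ratToU21_smul (hT := hT) γ z, h]
  · rw [sComp_of_ne _ h, sComp_of_ne _ h, Matrix.mul_one, ← Units.val_mul, mul_inv_cancel, Units.val_one]

/-- **`s_{ρ(γ)•z} = X_γ s_z X_γ⁻¹` in `GL₃(ℝ ⊗_ℚ M)`.** [cite: Deligne1979ShimuraVarieties, Prop. 2.3.10 (PDF p. 32)] -/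
theorem sPhi_ratToU21_smul (γ : rational (↥(maximalRealSubfield L)) L (IsCMField.complexConj L) 3 H)
    (z : BallModel.Ball) :
    sPhi M j Φ τ T (ratToU21 L H τ T hT γ • z) =
      unitaryToTensorReal M j H γ * sPhi M j Φ τ T z * (unitaryToTensorReal M j H γ)⁻¹ := by
  apply Units.ext
  rw [coe_sPhi, Units.val_mul, Units.val_mul, coe_sPhi, sMat_lift_ratToU21_smul (hT := hT) Φ γ z]

end Real

/-! ### §4. The real square and the equivariance of `J_{β,Φ}` -/

section Equivariance

variable {L : Type} [Field L] [NumberField L] [IsCMField L] {M : Type} [Field M] [NumberField M] [IsCMField M]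
  {j : L →+* M} {H : Matrix (Fin 3) (Fin 3) L} {ξ₀ ξ : M} {g : ℕ} {δ : Fin g → ℕ}
  (F : SymplecticFrame M j H ξ₀ ξ g δ) (τ : L →+* ℂ) (Φ : CMType M) (T : GL (Fin 3) ℂ)
  (hT : formCongr (starRingEnd ℂ) T (H.map τ) = BallModel.J)

/-- **The real square** `GSp_δ(ℚ) → GSp_δ(ℝ)` ∘ `auxToGspRat` = `auxRep ℝ` ∘ (transport to `ℝ ⊗ M`), at a unitary element
and trivial torus part: `(gspRationalToReal δ (auxToGspRat F (γ, 1)) : GL) = auxRep ℝ F (1, X_γ)` (naturality ★ `map_auxRep`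
along `ℚ → ℝ`). [cite: Deligne1979ShimuraVarieties, 2.1.2 (PDF p. 24)] [cite: Milne2005ShimuraVarieties, §5 (5.1) p. 56] -/
theorem coe_gspRationalToReal_auxToGspRat_one
    (γ : rational (↥(maximalRealSubfield L)) L (IsCMField.complexConj L) 3 H) :
    (gspRationalToReal δ (auxToGspRat F (γ, 1)) : GL (Fin g ⊕ Fin g) ℝ) = auxRep ℝ F (1, unitaryToTensorReal M j H γ) := by
  rw [coe_gspRationalToReal, coe_auxToGspRat, map_one]
  have h := map_auxRep (Algebra.ofId ℚ ℝ) F (1 : (ℚ ⊗[ℚ] M)ˣ) (unitaryToTensorRat M j H γ)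
  have hφ : ((Algebra.ofId ℚ ℝ : ℚ →ₐ[ℚ] ℝ) : ℚ →+* ℝ) = algebraMap ℚ ℝ := rfl
  rw [hφ] at h
  rw [h, map_one]
  rfl

/-- **Equivariance of the complex structure, `GL` form**: `J_{β,Φ}(ρ(γ) • z) = g · J_{β,Φ}(z) · g⁻¹` with
`g = gspRationalToReal δ (auxToGspRat F (γ, 1))` (`iPhi` is central, `s_{γz} = X_γ s_z X_γ⁻¹`, `auxRep` is a homomorphism).
[cite: Deligne1979ShimuraVarieties, Prop. 2.3.10, 2.1.2 (PDF pp. 32, 24)] [cite: Milne2005ShimuraVarieties, §6 p. 68] -/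
theorem auxComplexStructureGL_ratToU21_smul
    (γ : rational (↥(maximalRealSubfield L)) L (IsCMField.complexConj L) 3 H) (z : BallModel.Ball) :
    auxComplexStructureGL F τ Φ T (ratToU21 L H τ T hT γ • z) =
      (gspRationalToReal δ (auxToGspRat F (γ, 1)) : GL (Fin g ⊕ Fin g) ℝ) * auxComplexStructureGL F τ Φ T z *
        ((gspRationalToReal δ (auxToGspRat F (γ, 1)))⁻¹ : GL (Fin g ⊕ Fin g) ℝ) := by
  rw [coe_gspRationalToReal_auxToGspRat_one, auxComplexStructureGL, auxComplexStructureGL,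
    sPhi_ratToU21_smul (hT := hT) Φ γ z, ← map_inv (auxRep ℝ F), ← map_mul (auxRep ℝ F), ← map_mul (auxRep ℝ F),
    Prod.inv_mk, inv_one, Prod.mk_mul_mk, Prod.mk_mul_mk, one_mul, mul_one]

/-- **Equivariance of the complex structure `J_{β,Φ}(z)` under `U(H)(L⁺)`** (σ2 currency ★ `conjJ`):
`J_{β,Φ}(ρ(γ) • z) = conjJ (gspRationalToReal δ (auxToGspRat F (γ, 1))) (J_{β,Φ}(z))` — with ★
`gspRationalToFinAdelic_auxToGspRat` this is what makes `([x, a], p) ↦ [J_{β,Φ}(x), ũ(a, t_p)]` well defined on the double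
cosets of ★ `ShimuraSet.mk_eq_mk_iff` / ★ `SiegelShimuraSet.mk_eq_mk_iff`. [cite: Deligne1979ShimuraVarieties, Prop. 2.3.10, 2.1.2 (PDF pp. 32, 24)]
[cite: Milne2005ShimuraVarieties, Lemma 5.13 p. 57, §6 p. 68] -/
theorem auxComplexStructure_ratToU21_smul
    (γ : rational (↥(maximalRealSubfield L)) L (IsCMField.complexConj L) 3 H) (z : BallModel.Ball) :
    auxComplexStructure F τ Φ T (ratToU21 L H τ T hT γ • z) =
      conjJ (gspRationalToReal δ (auxToGspRat F (γ, 1)) : GL (Fin g ⊕ Fin g) ℝ) (auxComplexStructure F τ Φ T z) := by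
  rw [conjJ_def, auxComplexStructure, auxComplexStructure, auxComplexStructureGL_ratToU21_smul F τ Φ T hT γ z,
    Units.val_mul, Units.val_mul]

/-- **The real square at a torus element**: `(gspRationalToReal δ (auxToGspRat F (1, m)) : GL) = auxRep ℝ F (m_ℝ, 1)`,
`m_ℝ` the image of `m ∈ T₀(M)(ℚ)` in `(ℝ ⊗_ℚ M)ˣ`. [cite: Deligne1979ShimuraVarieties, 2.1.2 (PDF p. 24)] -/
theorem coe_gspRationalToReal_auxToGspRat_torus (m : torusRat M) :
    (gspRationalToReal δ (auxToGspRat F (1, m)) : GL (Fin g ⊕ Fin g) ℝ) =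
      auxRep ℝ F (Units.map ((Algebra.TensorProduct.map (Algebra.ofId ℚ ℝ) (AlgHom.id ℚ M) :
          ℚ ⊗[ℚ] M →ₐ[ℚ] ℝ ⊗[ℚ] M) : ℚ ⊗[ℚ] M →* ℝ ⊗[ℚ] M) (torusToTensorRat M m), 1) := by
  rw [coe_gspRationalToReal, coe_auxToGspRat, map_one]
  have h := map_auxRep (Algebra.ofId ℚ ℝ) F (torusToTensorRat M m) (1 : GL (Fin 3) (ℚ ⊗[ℚ] M))
  have hφ : ((Algebra.ofId ℚ ℝ : ℚ →ₐ[ℚ] ℝ) : ℚ →+* ℝ) = algebraMap ℚ ℝ := rfl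
  rw [hφ] at h
  rw [h, map_one]

/-- **Torus invariance of the complex structure**: `conjJ (ũ(1, m)_ℝ) (J_{β,Φ}(z)) = J_{β,Φ}(z)` for `m ∈ T₀(M)(ℚ)` — both
components of `(m_ℝ, 1)·(iPhi, s_z)·(m_ℝ, 1)⁻¹` are unchanged, `(ℝ ⊗_ℚ M)ˣ` being commutative (the torus half of the
well-definedness: changing the representative `t_p` by `m ∈ T₀(ℚ)`). [cite: Deligne1979ShimuraVarieties, Prop. 2.3.10, 2.1.2 (PDF pp. 32, 24)]
[cite: Milne2005ShimuraVarieties, §6 p. 68] -/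
theorem auxComplexStructure_torus_invariant (m : torusRat M) (z : BallModel.Ball) :
    conjJ (gspRationalToReal δ (auxToGspRat F (1, m)) : GL (Fin g ⊕ Fin g) ℝ) (auxComplexStructure F τ Φ T z) =
      auxComplexStructure F τ Φ T z := by
  rw [conjJ_def, coe_gspRationalToReal_auxToGspRat_torus, auxComplexStructure, auxComplexStructureGL,
    ← map_inv (auxRep ℝ F), ← Units.val_mul, ← Units.val_mul, ← map_mul (auxRep ℝ F), ← map_mul (auxRep ℝ F),
    Prod.inv_mk, inv_one, Prod.mk_mul_mk, Prod.mk_mul_mk, one_mul, mul_one, mul_inv_cancel_comm]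

/-- **Equivariance under `U(H)(ℚ) × T₀(M)(ℚ)`** (both halves): `J_{β,Φ}(ρ(γ) • z) = conjJ (ũ(γ, m)_ℝ) (J_{β,Φ}(z))` for every
`m ∈ T₀(M)(ℚ)`. [cite: Deligne1979ShimuraVarieties, Prop. 2.3.10, 2.1.2 (PDF pp. 32, 24)] [cite: Milne2005ShimuraVarieties, Lemma 5.13 p. 57] -/
theorem auxComplexStructure_ratToU21_smul_torus
    (γ : rational (↥(maximalRealSubfield L)) L (IsCMField.complexConj L) 3 H) (m : torusRat M) (z : BallModel.Ball) :
    auxComplexStructure F τ Φ T (ratToU21 L H τ T hT γ • z) =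
      conjJ (gspRationalToReal δ (auxToGspRat F (γ, m)) : GL (Fin g ⊕ Fin g) ℝ) (auxComplexStructure F τ Φ T z) := by
  have hsplit : auxToGspRat F (γ, m) = auxToGspRat F (1, m) * auxToGspRat F (γ, 1) := by
    rw [← map_mul, Prod.mk_mul_mk, one_mul, mul_one]
  rw [hsplit, map_mul, Subgroup.coe_mul, conjJ_mul, ← auxComplexStructure_ratToU21_smul F τ Φ T hT γ z,
    auxComplexStructure_torus_invariant]

end Equivariance

/-! ### §5. The `C0pm δ`-typed form (σ2 `conjAct` currency, over ★ `auxPoint`) -/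

section Point

open scoped ComplexOrder

variable {L : Type} [Field L] [NumberField L] [IsCMField L] {M : Type} [Field M] [NumberField M] [IsCMField M]
  {j : L →+* M} {H : Matrix (Fin 3) (Fin 3) L} {ξ₀ ξ : M} {g : ℕ} {δ : Fin g → ℕ}
  (F : SymplecticFrame M j H ξ₀ ξ g δ) (τ : L →+* ℂ) (Φ : CMType M) (T : GL (Fin 3) ℂ)
  (hT : formCongr (starRingEnd ℂ) T (H.map τ) = BallModel.J)
  (hξ₀ : ∀ ρ : Φ.1, (ρ.1 ξ₀).im < 0) (hξ : ∀ ρ : Φ.1, (ρ.1 ξ).im < 0)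
  (hpos : ∀ σ : L →+* ℂ, InfinitePlace.mk σ ≠ InfinitePlace.mk τ → (H.map σ).PosDef) (hΦ : IsExtAdapted τ j Φ)

/-- **Equivariance of the point `J_{β,Φ}(z) ∈ X = C0pm δ`** under `U(H)(ℚ) × T₀(M)(ℚ)`, in the σ2 action currency:
`auxPoint (ρ(γ) • z) = conjAct δ (ũ(γ, m)_ℝ) (auxPoint z)` — the literal shape consumed by ★ `SiegelShimuraSet.mk_eq_mk_iff`.
[cite: Deligne1979ShimuraVarieties, Prop. 2.3.10, 2.1.2 (PDF pp. 32, 24)] [cite: Milne2005ShimuraVarieties, Lemma 5.13 p. 57, §6 p. 68] -/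
theorem auxPoint_ratToU21_smul
    (γ : rational (↥(maximalRealSubfield L)) L (IsCMField.complexConj L) 3 H) (m : torusRat M) (z : BallModel.Ball) :
    auxPoint F τ Φ T (ratToU21 L H τ T hT γ • z) hT hξ₀ hξ hpos hΦ =
      conjAct δ (gspRationalToReal δ (auxToGspRat F (γ, m))) (auxPoint F τ Φ T z hT hξ₀ hξ hpos hΦ) :=
  Subtype.ext (by
    rw [coe_auxPoint, coe_conjAct, coe_auxPoint]
    exact auxComplexStructure_ratToU21_smul_torus F τ Φ T hT γ m z)

/-- **Torus invariance of the point**: `conjAct δ (ũ(1, m)_ℝ) (auxPoint z) = auxPoint z` for `m ∈ T₀(M)(ℚ)`.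
[cite: Deligne1979ShimuraVarieties, Prop. 2.3.10, 2.1.2 (PDF pp. 32, 24)] -/
theorem conjAct_torus_auxPoint (m : torusRat M) (z : BallModel.Ball) :
    conjAct δ (gspRationalToReal δ (auxToGspRat F (1, m))) (auxPoint F τ Φ T z hT hξ₀ hξ hpos hΦ) =
      auxPoint F τ Φ T z hT hξ₀ hξ hpos hΦ :=
  Subtype.ext (by
    rw [coe_conjAct, coe_auxPoint]
    exact auxComplexStructure_torus_invariant F τ Φ T m z)

end Point

end Aux

end UnitaryCanonicalModel

end Literature.AlgebraicGeometry.ShimuraVarieties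

end
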